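import Summits.QuantumFields.BalabanUV.T4Continuum.Spine.NE1p.DressedStabilityOfSuppliedSliceWinSchedules
import Summits.QuantumFields.BalabanUV.T4Continuum.Spine.NE1p.DressedTransportAssembledModSliceWinData

/-!
# T⁴ programme, spine estimate NE1′ (node O3b/H2) — THE CANONICAL TERMINAL FACE: END-ALL-slice-win ∘ SUPPLIERS OVER THE CANONICAL
# DATA — the row root `DressedStability 𝒯` (and ROOT-B) at every cutoff and run parameter from the WALL binders + DATA with NO
# bookkeeping function and NO bookkeeping equality displayed (swarm item S3l «canonical terminal face» of `t4/formal/NE1p/LEAVES.md`;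
# INTENT CLAIMS.log l.10990, taking leaf-01-g3's offer l.10609)

Cell `pub-balaban`, sub-cell `t4`, BINDER-OWNERS row NE1′, formalisation crew `b2b-balaban-t4-ne1p-formalise-*`, seat `…-leaf-09`
(gen 3; lineage rows S3∕S3b∕S3-sup∕S3d∕S3g∕S3h∕S3k).  ADDITIVE — imports this seat's `Spine/NE1p/DressedStabilityOfSuppliedSliceWinSchedules`
(S3k, p214938: THE TERMINAL FACE `dressedStability_of_suppliedSliceWinSchedules` — END-ALL-slice-win with F-8∕L-C∕L-B composed in) and
leaf-01-g3's `Spine/NE1p/DressedTransportAssembledModSliceWinData` (S2k, p214699: END-F′-mod-swin over the CANONICAL data, one-schedule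
form `transportLeaf_assembled_mod_swin_of_schedule_canonical`; through it leaf-01's S2i `DressedTransportAssembledModData` p213820 — the
plain recursions `aszRec`∕`s1Mod` and their defining equations `aszRec_birth`∕`aszRec_succ`∕`s1Mod_eq`) ONLY; modifies nothing.

WHY.  S3k's terminal face still displays, per `(a, K)`, the two FREE bookkeeping functions every assembled face carried since END-F′
(p212485): the closed-form fresh step budget `s1` (binder `hs1`, modulus form) and the slice sizes `Asz` (binders `hAsz_birth`∕
`hAsz_step`) — «equalities the instantiation defines» (typer R-T51 (i): «`hs1`∕`hAsz_*` removable by S2k's data»).  Leaf-01's S2i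
DEFINED them once by plain recursions on the scale; this file is the substitution `s1 a K := s1Mod (𝒯.T a K).gen r (alphaCell κ)
(c a K) (Sg a K) (δf a K)`, `Asz a K := aszRec (𝒯.T a K).gen (s a K) (s1 a K)` carried to the tower level, so that the THREE
bookkeeping binders and the TWO function families leave the terminal displayed list and NOTHING is added:
* §1 **`transportLeaf_assembled_swin_uniform_canonical_of_schedule`** [bookkeeping] — the per-cutoff function-level face: leaf-01's
  S2k END `transportLeaf_assembled_mod_swin_of_schedule_canonical W` BY NAME with its step-factor profile `hα` and (w4) `hdom`
  DISCHARGED from the displayed K-free ratio `hratio : ∀ k, 2σ k ≤ κ·ϱc k` at the CONSTANT profile `α := fun _ => alphaCell κ`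
  (S3g-1 `hdom_of_seqRatio` ∕ `hα_const` ∕ `κ_nonneg_win`) — i.e. S3h-1's `transportLeaf_assembled_swin_uniform_of_schedule` with
  `hs1`∕`hAsz_birth`∕`hAsz_step` GONE; conclusion VERBATIM the field type of `BookingLeaves.htr` (`C = 4c_δ∕r`, `ρ i = ψ·alphaCell κ`).
  The per-cutoff bundle is row S3's `bookingLeavesCell … (§1 …)` exactly as in S3h-1 §2 (not restated).
* §2 the tower-level binders ONCE as section variables = S3k's telescope MINUS {`hs1`, `hAsz_birth`, `hAsz_step`} and minus the
  implicit families {`s1`, `Asz`}; the H2 dictionary `hQ`∕`hSg` (what the canonical budget is computed from) and the two binders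
  particular to the slice-window face `hcm`∕`hδfwk` sit in each theorem's header (statements header-distinct from S3k∕S3i).
* §3 **`dressedStability_of_canonicalSliceWinSchedules : DressedStability 𝒯`**, `dressedStabilityWith_of_canonicalSliceWinSchedules`
  (constants `(A₀, rhoOne L⁻² (4c_δ∕r) c̄ κ, L⁻³)` displayed) and ROOT-B **`dressedBudget_of_canonicalSliceWinSchedules :
  DressedBudget 𝒯 wt`** = S3k's three theorems BY NAME at the canonical data, the three equalities being S2i's `s1Mod_eq`∕
  `aszRec_birth`∕`aszRec_succ`.

EFFECT — WHAT IS DISPLAYED AFTER THIS FACE, AND NOTHING ELSE (per `(a,K)` unless marked ONCE): the WALL∕Q leaves of `DAG.md` §2 —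
(w1) `hsl` (analytic births on the scheduled windows `bondBall d ((W a K).ρw k′)`, slice window `(W a K).wc k′`); (w2-act) `hB`∕`hE`∕`hs₀`
(printed TYPE [Balaban1989LargeFieldII] (1.65) p. 375, (1.71)–(1.75) pp. 379–380 — THE NUMBER `s̄⁰` stays a binder, (w6) `hsmall` ONCE);
(w5) `hreg` + `hc0`∕`hcb`; (I4′) `hδf`∕`hδfwk`∕`hpairx`∕`hdefwk`∕`hrate` + the cutoff-free source tie `hcm` (F-6's rate `ψ = L⁻²`, k3 —
load-bearing); the F-2∕H2 dictionary `hFn`∕`h𝒢`∕`hQ`∕`hSg`∕`hmeas`; F-9 context `hinv`∕`hDμ`∕`hz₁` — plus instantiation DATA (one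
`WindowScheduleModWin` per `(a,K)` with ratio `hratio` — ONE cutoff-free geometric schedule serves all, S3h-2 §3, exact admissibility =
summability, S1g; anchoring `Anch`∕`hLb`∕`hmult`∕`hscale`∕`hhoused`∕`hvol`; absorption `holder`∕`hsub`∕`habs`∕`hβ`; booking convention
`hne`∕`hsup`) and row S3's located scalars ONCE before `∀ a K` (`κ L c̄ N₀ A₀ s̄⁰ ρ′ r c_δ m v mB A β₀`; `hloc : locCell … ≤ ρ′ < 1`,
`hsmall`, `hvN₀`, `hfan`, `hamp`).  NO structural leaf, NO `hP`, NO radius floor, NO uniform-`w` window budget, NO `K·w`, NO posited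
count, NO bookkeeping function, NO bookkeeping equality.  The K-uniformity CONTENT of NE1′ sits ENTIRELY in the eight WALL families +
`hcm` + the two LF-3 guards at fixed scalars.  R4 rider (caveat k1, inherited from rows S4∕S3i and restated here so the terminal face
is self-contained): the component volume `v` and the multiplicity `mB` are bound ONCE — this is the form in which a COLLARED met
component (a large-field component inside a cube of `100M R_k` plus its collar layers, row S4 `DressedPositionalCount`) is K-free; it is
the ONE K-free instantiation demand of L-C and is NOT asserted here for Bałaban's large-field components.

HONEST FRAMING.  Kernel composition ∕ instantiation over hypothesis shapes ([folklore]; 0 sorry; 0 citations used as facts; no `def`,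
no `def … : Prop`).  Headline (c4): «NE1′ (all cutoffs, all run parameters) ⇐ EXACTLY the displayed WALL binders ∀ (a,K) + anchoring ∕
absorption ∕ booking-convention DATA + located largeness + ratio-bounded cutoff-free-window schedules — NOT proved, NOT printed; 0
binders instantiated on Bałaban's densities»; spine PROVED 0∕9.  Rung (B)+1 on ONE finite four-torus — NOT infinite volume, NOT a
mass gap, NOT OS on ℝ⁴, NOT Clay.  HONEST DEPENDENCY: continuum YM on T⁴ ⇐ BetaPertH ∧ nine spine estimates (0/9 proved); BetaPertH ⇐
(D1) ∧ (D4) ∧ CAP+tail; G-an2-4 gates asym, D1 and NE2/3/4.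
-/

noncomputable section

namespace Summit.QuantumFields.BalabanUV.T4Continuum.NE1p.DressedStabilityOfCanonicalSliceWinSchedules

open MeasureTheory Set Metric Finset
open scoped BigOperators
open Literature.MathematicalPhysics.QuantumFieldTheory.Balaban1983to89
open Literature.MathematicalPhysics.QuantumFieldTheory.Balaban1983to89.T4TermFormat
open Literature.MathematicalPhysics.QuantumFieldTheory.Balaban1983to89.T4FeltGeometry
open Literature.MathematicalPhysics.QuantumFieldTheory.Balaban1983to89.T4GatedBooking
open Literature.MathematicalPhysics.QuantumFieldTheory.Balaban1983to89.T4TrajectoryComparison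
open Literature.MathematicalPhysics.QuantumFieldTheory.Balaban1983to89.T4TrajectoryModulus
open T4BirthChartTransport (GaugeInvariant BirthSlice RelGauge)
open T4BlockTransport (Fld NDir latMove latN)
open T4TrajectoryDensity
open Summit.QuantumFields.BalabanUV.T4Continuum.T4TrajectoryDensityDressed
open Summit.QuantumFields.BalabanUV.T4Continuum.NE1p.DressedRoot
open Summit.QuantumFields.BalabanUV.T4Continuum.NE1p.DressedWindowScheduleWin
open Summit.QuantumFields.BalabanUV.T4Continuum.NE1p.DressedWindowScheduleModWin
open Summit.QuantumFields.BalabanUV.T4Continuum.NE1p.DressedUniformConstants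
open Summit.QuantumFields.BalabanUV.T4Continuum.NE1p.DressedTransportUniformWin
open Summit.QuantumFields.BalabanUV.T4Continuum.NE1p.DressedTransportAssembledModData
open Summit.QuantumFields.BalabanUV.T4Continuum.NE1p.DressedTransportAssembledModSliceWinData
open Summit.QuantumFields.BalabanUV.T4Continuum.NE1p.DressedStabilityOfSuppliedSliceWinSchedules
open Summit.QuantumFields.BalabanUV.T4Continuum.NE1p.DressedAbsorptionWindow
open Summit.QuantumFields.BalabanUV.T4Continuum.NE1p.DressedAttainment

/-! ## §1 The per-cutoff function-level face over the canonical data with (w4) discharged -/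

section FunctionLevel

variable {r w : ℝ} (W : WindowScheduleModWin r w)
variable {B : T4TermFormat.Booking} {T : Trajectory B}
variable {R : Type*} [NormedRing R] [NormedAlgebra ℂ R] [MeasurableSpace R] {d : ℕ}

/-- **THE ASSEMBLED SLICE-WINDOW TRANSPORT LEAF OVER THE CANONICAL DATA UNDER A RATIO-BOUNDED `WindowScheduleModWin` — NO
BOOKKEEPING FUNCTION, NO WINDOW GEOMETRY, NO FLOOR, NO `hP`, NO (w4) BINDER** [bookkeeping]: leaf-01's S2k END
`transportLeaf_assembled_mod_swin_of_schedule_canonical W` BY NAME with the step-factor profile FIXED to the K-free constant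
`α := fun _ => alphaCell κ` for a displayed ratio bound `hratio : ∀ k, 2σ k ≤ κ·ϱc k` (S3g-1 `hdom_of_seqRatio` ∕ `hα_const` through
`W.toWindowScheduleWin`).  Displayed = estimate ∕ dictionary ∕ context binders ONLY: (w1) `hsl`; F-2 `hFn`∕`h𝒢` + the H2 dictionary
`hQ`∕`hSg`; (w2-act) `hB`∕`hE`; the cutoff-free source tie `hcm`; (I4′) `hδf`∕`hδfwk`∕`hpairx`∕`hdefwk`∕`hrate`; `hDμ`∕`hz₁`; F-8 `hlin`;
`hinv`∕`hmeas`; signs `hr`∕`hcδ`∕`hψ`; `hratio` — and NO `hs1`∕`hAsz_birth`∕`hAsz_step` (the fresh step budget and the slice sizes ARE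
`s1Mod`∕`aszRec`).  Conclusion: VERBATIM the field type of `BookingLeaves.htr` with `C = 4c_δ∕r`, `ρ i = ψ·alphaCell κ`.  Nothing of
Bałaban's densities is asserted. [folklore] -/
theorem transportLeaf_assembled_swin_uniform_canonical_of_schedule {κ : ℝ} {Fn : B.Birth → ℕ → ℕ → Fld d R → ℂ}
    {rel : B.Birth → ℕ → ℕ → Fld d R → Fld d R → Prop}
    {ref : B.Birth → ℕ → Fld d R → Fld d R} {base : B.Birth → ℕ → Fld d R → ℝ}
    {𝒜 𝒬 : B.Birth → ℕ → Fld d R → Fld d R → ℂ} {q : B.Birth → ℕ → Fld d R → ℂ}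
    {μ : B.Birth → ℕ → Measure (Fld d R)} {z₀ z₁ : B.Birth → ℕ → Fld d R}
    {defect : B.Birth → ℕ → ℕ → ℝ} {cδ ψ m : ℝ} {s : B.Birth → ℕ → ℝ}
    {S : ℕ → B.Birth → Finset B.Birth} {Sg : ℕ → B.Birth → Finset (B.Birth × ℕ)} {c : B.Birth → ℕ → ℂ}
    {δf : B.Birth → ℕ → B.Birth × ℕ → ℝ}
    (hratio : ∀ k, 2 * W.σ k ≤ κ * W.ϱc k)
    (hr : 0 < r) (hcδ : 0 ≤ cδ) (hψ : 0 ≤ ψ)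
    (hsl : ∀ (b : B.Birth) (k' : ℕ), B.birthScale b ≤ k' → k' ≤ B.K →
      RanBelow (budgetGate T s m S (4 * cδ / r) (fun i => ψ * (fun _ : ℕ => alphaCell κ) i)) k' →
      BirthSlice (Fn b k' k') latMove latN (bondBall d (W.ρw k') : Set (Fld d R)) (W.wc k') r (T.gen b k'))
    (hFn : ∀ (b : B.Birth) (k' k : ℕ), B.birthScale b ≤ k' → k' ≤ k → k + 1 ≤ B.K →
      RanBelow (budgetGate T s m S (4 * cδ / r) (fun i => ψ * (fun _ : ℕ => alphaCell κ) i)) (k + 1) →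
      ∀ U, Fn b k' (k + 1) U =
        wOp (expWeight (base b k) (𝒜 b k + 𝒬 b k)) (μ b k) (z₀ b k) U (fun z => Fn b k' k (U + z)))
    (h𝒢 : ∀ (b : B.Birth) (k' k : ℕ), B.birthScale b ≤ k' → k' ≤ k → k + 1 ≤ B.K →
      RanBelow (budgetGate T s m S (4 * cδ / r) (fun i => ψ * (fun _ : ℕ => alphaCell κ) i)) (k + 1) →
      ∀ U, (fun z => Fn b k' k (U + z)) ∈ BddClass ℂ (μ b k))
    (hB : ∀ (b : B.Birth) (k' k : ℕ), B.birthScale b ≤ k' → k' ≤ k → k + 1 ≤ B.K →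
      RanBelow (budgetGate T s m S (4 * cδ / r) (fun i => ψ * (fun _ : ℕ => alphaCell κ) i)) (k + 1) →
      RealBaseAt (ref b k) (base b k) (𝒜 b k) (μ b k) (bondBall d (W.ρw (k + 1)) : Set (Fld d R)))
    (hE : ∀ (b : B.Birth) (k' k : ℕ), B.birthScale b ≤ k' → k' ≤ k → k + 1 ≤ B.K →
      RanBelow (budgetGate T s m S (4 * cδ / r) (fun i => ψ * (fun _ : ℕ => alphaCell κ) i)) (k + 1) →
      ExponentSliceAt (ref b k) (𝒜 b k) (μ b k) latMove latN (bondBall d (W.ρw (k + 1)) : Set (Fld d R)) (W.wc (k + 1))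
        (W.ϱc k) (s b k))
    -- the Assembly's dictionary: the centred observable-attached exponent IS the fresh sum over the live generations
    (hQ : ∀ b k, (fun U z => 𝒬 b k U z - q b k U) =
      fun U z => c b k * ∑ p ∈ Sg k b, (Fn p.1 p.2 k (U + z) - Fn p.1 p.2 k (U + z₁ b k)))
    (hSg : ∀ k b, ∀ p ∈ Sg k b, p.1 ∈ S k b ∧ B.birthScale p.1 ≤ p.2 ∧ p.2 ≤ k)
    -- the cutoff-free source-vs-budget condition
    (hcm : ∀ b k, ‖c b k‖ ≤ m)
    (hδf : ∀ b k, ∀ p ∈ Sg k b, 0 ≤ δf b k p ∧ δf b k p ≤ cδ * ψ ^ (k - p.2))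
    (hδfwk : ∀ b k, ∀ p ∈ Sg k b, δf b k p ≤ W.wc k)
    (hDμ : ∀ b k, ∀ᵐ z ∂μ b k, z ∈ (bondBall d (W.σ k) : Set (Fld d R)))
    (hz₁ : ∀ b k, z₁ b k ∈ (bondBall d (W.σ k) : Set (Fld d R)))
    (hpairx : ∀ (b : B.Birth) (k' k : ℕ), B.birthScale b ≤ k' → k' ≤ k →
      ∀ p ∈ Sg k b, ∀ U₀ ∈ (bondBall d (W.ρw (k + 1)) : Set (Fld d R)), ∀ pd : NDir d R, 0 < latN pd →
        latN pd ≤ W.wc (k + 1) →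
        ∀ᵐ z ∂μ b k, ∀ t ∈ tube (W.ϱ₁ k / latN pd),
          RelGauge (rel p.1 p.2 k) latMove latN (latMove U₀ pd t + z₁ b k) (latMove U₀ pd t + z) (δf b k p))
    (hinv : ∀ b k' k, GaugeInvariant (rel b k' k) (Fn b k' k))
    (hmeas : ∀ (b f : B.Birth) (k'' k : ℕ) (U : Fld d R), AEStronglyMeasurable (fun z => Fn f k'' k (U + z)) (μ b k))
    (hdefwk : ∀ (b : B.Birth) (k' k : ℕ), defect b k' k ≤ W.wc k)
    (hrate : ∀ (b : B.Birth) (k' k : ℕ), B.birthScale b ≤ k' → k' ≤ k → k ≤ B.K →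
      defect b k' k ≤ cδ * ψ ^ (k - k'))
    (hlin : ∀ (b : B.Birth) (k' k : ℕ), B.birthScale b ≤ k' → k' ≤ k → k ≤ B.K →
      RanBelow (budgetGate T s m S (4 * cδ / r) (fun i => ψ * (fun _ : ℕ => alphaCell κ) i)) k → ∀ ε > 0,
      ∃ U₀ ∈ (bondBall d (W.ρw k) : Set (Fld d R)), ∃ U₁ : Fld d R,
        RelGauge (rel b k' k) latMove latN U₀ U₁ (defect b k' k) ∧
        T.lin b k' k ≤ ‖Fn b k' k U₁ - Fn b k' k U₀‖ + ε) :
    T.TransportsFromVar (4 * cδ / r) (fun i => ψ * (fun _ : ℕ => alphaCell κ) i)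
      (budgetGate T s m S (4 * cδ / r) (fun i => ψ * (fun _ : ℕ => alphaCell κ) i)) :=
  transportLeaf_assembled_mod_swin_of_schedule_canonical W (α := fun _ : ℕ => alphaCell κ)
    (hα_const (κ_nonneg_win W.toWindowScheduleWin hratio)) hr hcδ hψ hsl hFn h𝒢 hB hE hQ hSg hcm hδf hδfwk hDμ hz₁ hpairx
    (hdom_of_seqRatio (B := B) W.hϱc hratio) hinv hmeas hdefwk hrate hlin

end FunctionLevel

/-! ## §2 The tower-level binders, once — S3k's telescope minus `hs1`∕`hAsz_birth`∕`hAsz_step` and minus the families `s1`∕`Asz` -/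

section EndAll

variable {P : Type*} (𝒯 : DressedTower P)
variable {R : Type*} [NormedRing R] [NormedAlgebra ℂ R] [MeasurableSpace R] {d : ℕ}
variable {κ L cbar N₀ A₀ sbar ρ' r cδ m : ℝ} {w : P → ℕ → ℝ}
variable (W : ∀ (a : P) (K : ℕ), WindowScheduleModWin r (w a K)) (hκ : 0 ≤ κ)
variable {Fn : ∀ (a : P) (K : ℕ), (𝒯.B a K).Birth → ℕ → ℕ → Fld d R → ℂ}
  {rel : ∀ (a : P) (K : ℕ), (𝒯.B a K).Birth → ℕ → ℕ → Fld d R → Fld d R → Prop}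
  {ref : ∀ (a : P) (K : ℕ), (𝒯.B a K).Birth → ℕ → Fld d R → Fld d R}
  {base : ∀ (a : P) (K : ℕ), (𝒯.B a K).Birth → ℕ → Fld d R → ℝ}
  {𝒜 𝒬 : ∀ (a : P) (K : ℕ), (𝒯.B a K).Birth → ℕ → Fld d R → Fld d R → ℂ}
  {q : ∀ (a : P) (K : ℕ), (𝒯.B a K).Birth → ℕ → Fld d R → ℂ}
  {μ : ∀ (a : P) (K : ℕ), (𝒯.B a K).Birth → ℕ → Measure (Fld d R)}
  {z₀ z₁ : ∀ (a : P) (K : ℕ), (𝒯.B a K).Birth → ℕ → Fld d R}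
  {defect : ∀ (a : P) (K : ℕ), (𝒯.B a K).Birth → ℕ → ℕ → ℝ}
  {s : ∀ (a : P) (K : ℕ), (𝒯.B a K).Birth → ℕ → ℝ}
  {S : ∀ (a : P) (K : ℕ), ℕ → (𝒯.B a K).Birth → Finset (𝒯.B a K).Birth}
  {Sg : ∀ (a : P) (K : ℕ), ℕ → (𝒯.B a K).Birth → Finset ((𝒯.B a K).Birth × ℕ)}
  {c : ∀ (a : P) (K : ℕ), (𝒯.B a K).Birth → ℕ → ℂ}
  {δf : ∀ (a : P) (K : ℕ), (𝒯.B a K).Birth → ℕ → (𝒯.B a K).Birth × ℕ → ℝ}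
  {creg : ∀ (_ : P) (_ : ℕ), ℕ → ℝ}
-- DATA replacing the structural leaves: anchoring (L-C), absorption (L-B)
variable {Lb mB v : ℕ} (Anch : ∀ (a : P) (K : ℕ), Anchoring (𝒯.B a K) 4 Lb)
  {comp : ∀ (a : P) (K : ℕ), ℕ → (𝒯.B a K).Birth → Finset (𝒯.B a K).Cube}
  {Sabs : ∀ (a : P) (K : ℕ), (𝒯.B a K).Birth → Finset (𝒯.B a K).Birth}
  {β : ∀ (_ : P) (_ : ℕ), ℕ → ℝ} {A β₀ : ℝ}

-- the ratio family (K-free κ)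
variable (hratio : ∀ (a : P) (K : ℕ), ∀ k, 2 * (W a K).σ k ≤ κ * (W a K).ϱc k)
-- row S3's located scalars ((w7) largeness, (w6) window) and signs — ONCE
variable (hL : 1 ≤ L)
variable (hcbar : 0 ≤ cbar)
variable (hN₀ : 0 ≤ N₀)
variable (hA₀ : 0 ≤ A₀)
variable (hm : 0 ≤ m)
variable (hloc : locCell L (4 * cδ / r) cbar κ ≤ ρ')
variable (hρ'1 : ρ' < 1)
variable (hsmall : m * (N₀ * A₀ * (1 - ρ')⁻¹) ≤ 1 - sbar)
variable (hr : 0 < r)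
variable (hcδ : 0 ≤ cδ)
-- the assembled END's estimate families (S3k verbatim)
variable (hsl : ∀ (a : P) (K : ℕ), ∀ (b : (𝒯.B a K).Birth) (k' : ℕ), (𝒯.B a K).birthScale b ≤ k' → k' ≤ (𝒯.B a K).K →
  RanBelow (budgetGate (𝒯.T a K) (s a K) m (S a K) (4 * cδ / r) (fun i => (L ^ 2)⁻¹ * (fun _ : ℕ => alphaCell κ) i)) k' →
  BirthSlice ((Fn a K) b k' k') latMove latN (bondBall d ((W a K).ρw k') : Set (Fld d R)) ((W a K).wc k') r ((𝒯.T a K).gen b k'))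
variable (hFn : ∀ (a : P) (K : ℕ), ∀ (b : (𝒯.B a K).Birth) (k' k : ℕ), (𝒯.B a K).birthScale b ≤ k' → k' ≤ k →
  k + 1 ≤ (𝒯.B a K).K →
  RanBelow (budgetGate (𝒯.T a K) (s a K) m (S a K) (4 * cδ / r) (fun i => (L ^ 2)⁻¹ * (fun _ : ℕ => alphaCell κ) i)) (k + 1) →
  ∀ U, (Fn a K) b k' (k + 1) U =
    wOp (expWeight ((base a K) b k) ((𝒜 a K) b k + (𝒬 a K) b k)) ((μ a K) b k) ((z₀ a K) b k) U (fun z => (Fn a K) b k' k (U + z)))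
variable (h𝒢 : ∀ (a : P) (K : ℕ), ∀ (b : (𝒯.B a K).Birth) (k' k : ℕ), (𝒯.B a K).birthScale b ≤ k' → k' ≤ k →
  k + 1 ≤ (𝒯.B a K).K →
  RanBelow (budgetGate (𝒯.T a K) (s a K) m (S a K) (4 * cδ / r) (fun i => (L ^ 2)⁻¹ * (fun _ : ℕ => alphaCell κ) i)) (k + 1) →
  ∀ U, (fun z => (Fn a K) b k' k (U + z)) ∈ BddClass ℂ ((μ a K) b k))
variable (hB : ∀ (a : P) (K : ℕ), ∀ (b : (𝒯.B a K).Birth) (k' k : ℕ), (𝒯.B a K).birthScale b ≤ k' → k' ≤ k →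
  k + 1 ≤ (𝒯.B a K).K →
  RanBelow (budgetGate (𝒯.T a K) (s a K) m (S a K) (4 * cδ / r) (fun i => (L ^ 2)⁻¹ * (fun _ : ℕ => alphaCell κ) i)) (k + 1) →
  RealBaseAt ((ref a K) b k) ((base a K) b k) ((𝒜 a K) b k) ((μ a K) b k) (bondBall d ((W a K).ρw (k + 1)) : Set (Fld d R)))
variable (hE : ∀ (a : P) (K : ℕ), ∀ (b : (𝒯.B a K).Birth) (k' k : ℕ), (𝒯.B a K).birthScale b ≤ k' → k' ≤ k →
  k + 1 ≤ (𝒯.B a K).K →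
  RanBelow (budgetGate (𝒯.T a K) (s a K) m (S a K) (4 * cδ / r) (fun i => (L ^ 2)⁻¹ * (fun _ : ℕ => alphaCell κ) i)) (k + 1) →
  ExponentSliceAt ((ref a K) b k) ((𝒜 a K) b k) ((μ a K) b k) latMove latN (bondBall d ((W a K).ρw (k + 1)) : Set (Fld d R))
    ((W a K).wc (k + 1)) ((W a K).ϱc k) ((s a K) b k))
variable (hδf : ∀ (a : P) (K : ℕ), ∀ b k, ∀ x ∈ (Sg a K) k b, 0 ≤ (δf a K) b k x ∧ (δf a K) b k x ≤ cδ * ((L ^ 2)⁻¹) ^ (k - x.2))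
variable (hDμ : ∀ (a : P) (K : ℕ), ∀ b k, ∀ᵐ z ∂(μ a K) b k, z ∈ (bondBall d ((W a K).σ k) : Set (Fld d R)))
variable (hz₁ : ∀ (a : P) (K : ℕ), ∀ b k, (z₁ a K) b k ∈ (bondBall d ((W a K).σ k) : Set (Fld d R)))
variable (hpairx : ∀ (a : P) (K : ℕ), ∀ (b : (𝒯.B a K).Birth) (k' k : ℕ), (𝒯.B a K).birthScale b ≤ k' → k' ≤ k →
  ∀ x ∈ (Sg a K) k b, ∀ U₀ ∈ (bondBall d ((W a K).ρw (k + 1)) : Set (Fld d R)), ∀ pd : NDir d R, 0 < latN pd →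
    latN pd ≤ (W a K).wc (k + 1) →
    ∀ᵐ z ∂(μ a K) b k, ∀ t ∈ tube ((W a K).ϱ₁ k / latN pd),
      RelGauge ((rel a K) x.1 x.2 k) latMove latN (latMove U₀ pd t + (z₁ a K) b k) (latMove U₀ pd t + z) ((δf a K) b k x))
variable (hinv : ∀ (a : P) (K : ℕ), ∀ b k' k, GaugeInvariant ((rel a K) b k' k) ((Fn a K) b k' k))
variable (hmeas : ∀ (a : P) (K : ℕ), ∀ (b f : (𝒯.B a K).Birth) (k'' k : ℕ) (U : Fld d R),
  AEStronglyMeasurable (fun z => (Fn a K) f k'' k (U + z)) ((μ a K) b k))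
variable (hdefwk : ∀ (a : P) (K : ℕ), ∀ (b : (𝒯.B a K).Birth) (k' k : ℕ), (defect a K) b k' k ≤ (W a K).wc k)
variable (hrate : ∀ (a : P) (K : ℕ), ∀ (b : (𝒯.B a K).Birth) (k' k : ℕ), (𝒯.B a K).birthScale b ≤ k' → k' ≤ k → k ≤ (𝒯.B a K).K →
  (defect a K) b k' k ≤ cδ * ((L ^ 2)⁻¹) ^ (k - k'))
-- F-8 REPLACED BY THE BOOKING CONVENTION (row S8): admissible pairs exist, booked size ≤ sup of realised increments
variable (hne : ∀ (a : P) (K : ℕ), ∀ (b : (𝒯.B a K).Birth) (k' k : ℕ), (𝒯.B a K).birthScale b ≤ k' → k' ≤ k → k ≤ (𝒯.B a K).K →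
  RanBelow (budgetGate (𝒯.T a K) (s a K) m (S a K) (4 * cδ / r) (fun i => (L ^ 2)⁻¹ * (fun _ : ℕ => alphaCell κ) i)) k →
  ∃ U₀ ∈ (bondBall d ((W a K).ρw k) : Set (Fld d R)), ∃ U₁ : Fld d R,
  RelGauge ((rel a K) b k' k) latMove latN U₀ U₁ ((defect a K) b k' k))
variable (hsup : ∀ (a : P) (K : ℕ), ∀ (b : (𝒯.B a K).Birth) (k' k : ℕ), (𝒯.B a K).birthScale b ≤ k' → k' ≤ k → k ≤ (𝒯.B a K).K →
  RanBelow (budgetGate (𝒯.T a K) (s a K) m (S a K) (4 * cδ / r) (fun i => (L ^ 2)⁻¹ * (fun _ : ℕ => alphaCell κ) i)) k →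
  (𝒯.T a K).lin b k' k ≤ sSup {x : ℝ | ∃ U₀ ∈ (bondBall d ((W a K).ρw k) : Set (Fld d R)), ∃ U₁ : Fld d R,
    RelGauge ((rel a K) b k' k) latMove latN U₀ U₁ ((defect a K) b k' k) ∧ x = ‖(Fn a K) b k' k U₁ - (Fn a K) b k' k U₀‖})
-- the booking-level wall binders: (w5) regeneration, (w2-act) margin
variable (hc0 : ∀ (a : P) (K : ℕ), ∀ k, 0 ≤ (creg a K) k)
variable (hcb : ∀ (a : P) (K : ℕ), ∀ k, k < (𝒯.B a K).K → (creg a K) k ≤ cbar)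
variable (hreg : ∀ (a : P) (K : ℕ), (𝒯.T a K).RegeneratesFromVar (creg a K)
  (budgetGate (𝒯.T a K) (s a K) m (S a K) (4 * cδ / r) (fun _ : ℕ => (L ^ 2)⁻¹ * alphaCell κ)))
variable (hs₀ : ∀ (a : P) (K : ℕ), ∀ b k, (s a K) b k ≤ sbar)
-- (w3-book) L-C REPLACED BY ANCHORING DATA (row S4): blocking integer, multiplicity, housing, component volume
variable (hLb : (Lb : ℝ) = L)
variable (hmult : ∀ (a : P) (K : ℕ), ∀ j (x : Fin 4 → ℕ),
  ((𝒯.B a K).births.filter fun b => (𝒯.B a K).birthScale b = j ∧ x ∈ (Anch a K).dom b).card ≤ mB)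
variable (hscale : ∀ (a : P) (K : ℕ), ∀ k b, ∀ q ∈ (comp a K) k b, (𝒯.B a K).cubeScale q = k)
variable (hhoused : ∀ (a : P) (K : ℕ), ∀ k b, ∀ f ∈ (S a K) k b, ∃ q ∈ (comp a K) k b, f ∈ (𝒯.B a K).feltAt q)
variable (hvol : ∀ (a : P) (K : ℕ), ∀ k b, ((comp a K) k b).card ≤ v)
-- (w1)+(w5b) L-B REPLACED BY ABSORPTION DATA (rows S5 ∕ S5b)
variable (holder : ∀ (a : P) (K : ℕ), ∀ b b₀, b₀ ∈ (Sabs a K) b → (𝒯.B a K).birthScale b₀ < (𝒯.B a K).birthScale b)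
variable (hsub : ∀ (a : P) (K : ℕ), ∀ b, (Sabs a K) b ⊆ (S a K) ((𝒯.B a K).birthScale b) b)
variable (habs : ∀ (a : P) (K : ℕ), (𝒯.T a K).AbsorbsFrom (4 * cδ / r) (fun _ : ℕ => (L ^ 2)⁻¹ * alphaCell κ) (β a K) A (Sabs a K)
  (budgetGate (𝒯.T a K) (s a K) m (S a K) (4 * cδ / r) (fun _ : ℕ => (L ^ 2)⁻¹ * alphaCell κ)))
variable (hβ : ∀ (a : P) (K : ℕ), ∀ j, j ≤ (𝒯.B a K).K → (β a K) j ≤ β₀ * (L⁻¹ ^ 3) ^ ((𝒯.B a K).K - j))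

include W hκ Anch hratio hL hcbar hN₀ hA₀ hm hloc hρ'1 hsmall hr hcδ hsl hFn h𝒢 hB hE hδf hDμ hz₁ hpairx hinv hmeas hdefwk hrate
  hne hsup hc0 hcb hreg hs₀ hLb hmult hscale hhoused hvol holder hsub habs hβ

/-! ## §3 END-ALL-slice-win ∘ suppliers over the canonical data: the row root (both forms) and ROOT-B -/

/-- **THE CANONICAL TERMINAL FACE — THE ROW ROOT WITH ITS CONSTANTS DISPLAYED** [bookkeeping]: S3k's
`dressedStabilityWith_of_suppliedSliceWinSchedules` BY NAME at the canonical data `s1 a K := s1Mod (𝒯.T a K).gen r (alphaCell κ)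
(c a K) (Sg a K) (δf a K)` (the closed-form fresh step budget, modulus form) and `Asz a K := aszRec (𝒯.T a K).gen (s a K) (s1 a K)`
(the slice sizes), its three bookkeeping binders being S2i's `s1Mod_eq` ∕ `aszRec_birth` ∕ `aszRec_succ`.  The header displays the
H2 dictionary `hQ`∕`hSg` (the source factor `c` and the live generations `Sg` the canonical budget is computed from) and the two
binders particular to the slice-window face (`hcm`, `hδfwk`), then row S3's supplier scalars.  The scalars
(`κ L c̄ N₀ A₀ s̄⁰ ρ′ r c_δ m v mB A β₀`) precede `∀ a K`.  NOT «NE1′ proved»: every wall binder displayed; 0 instantiated on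
Bałaban's densities. [folklore] -/
theorem dressedStabilityWith_of_canonicalSliceWinSchedules
    -- the H2 dictionary the canonical data are built from
    (hQ : ∀ (a : P) (K : ℕ), ∀ b k, (fun U z => (𝒬 a K) b k U z - (q a K) b k U) =
      fun U z => (c a K) b k * ∑ x ∈ (Sg a K) k b, ((Fn a K) x.1 x.2 k (U + z) - (Fn a K) x.1 x.2 k (U + (z₁ a K) b k)))
    (hSg : ∀ (a : P) (K : ℕ), ∀ k b, ∀ x ∈ (Sg a K) k b, x.1 ∈ (S a K) k b ∧ (𝒯.B a K).birthScale x.1 ≤ x.2 ∧ x.2 ≤ k)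
    -- the two binders PARTICULAR to the assembled slice-window face (cutoff-free source tie, per-step slice guard)
    (hcm : ∀ (a : P) (K : ℕ), ∀ b k, ‖(c a K) b k‖ ≤ m)
    (hδfwk : ∀ (a : P) (K : ℕ), ∀ b k, ∀ x ∈ (Sg a K) k b, (δf a K) b k x ≤ (W a K).wc k)
    (hvN₀ : (v : ℝ) * mB ≤ N₀) (hA : 0 ≤ A)
    (hfan : fanout A N₀ ρ' < 1) (hamp : absorbAmplitude β₀ A N₀ ρ' ≤ A₀) :
    DressedStabilityWith 𝒯 A₀ (rhoOne (L ^ 2)⁻¹ (4 * cδ / r) cbar κ) (L⁻¹ ^ 3) :=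
  dressedStabilityWith_of_suppliedSliceWinSchedules 𝒯 W hκ
    (s1 := fun a K => s1Mod (𝒯.T a K).gen r (fun _ : ℕ => alphaCell κ) (c a K) (Sg a K) (δf a K))
    (Asz := fun a K =>
      aszRec (𝒯.T a K).gen (s a K) (s1Mod (𝒯.T a K).gen r (fun _ : ℕ => alphaCell κ) (c a K) (Sg a K) (δf a K)))
    Anch hratio hL hcbar hN₀ hA₀ hm hloc hρ'1 hsmall hr hcδ hsl hFn h𝒢 hB hE hQ hSg
    (fun a K b k => s1Mod_eq (𝒯.T a K).gen r (fun _ : ℕ => alphaCell κ) (c a K) (Sg a K) (δf a K) b k)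
    (fun a K f k'' =>
      aszRec_birth (𝒯.T a K).gen (s a K) (s1Mod (𝒯.T a K).gen r (fun _ : ℕ => alphaCell κ) (c a K) (Sg a K) (δf a K)) f k'')
    (fun a K f _ _ _ hk =>
      aszRec_succ (𝒯.T a K).gen (s a K) (s1Mod (𝒯.T a K).gen r (fun _ : ℕ => alphaCell κ) (c a K) (Sg a K) (δf a K)) f hk)
    hδf hDμ hz₁ hpairx hinv hmeas hdefwk hrate hne hsup hc0 hcb hreg hs₀ hLb hmult hscale hhoused hvol holder hsub habs hβ hcm
    hδfwk hvN₀ hA hfan hamp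

/-- **THE CANONICAL TERMINAL FACE — THE ROW ROOT `DressedStability 𝒯` LITERALLY** [bookkeeping]: «NE1′ (all cutoffs, all run
parameters) ⇐ EXACTLY the displayed WALL binders ∀ (a,K) + the H2 dictionary + anchoring ∕ absorption ∕ booking-convention DATA +
located largeness + ratio-bounded cutoff-free-window schedules», with NO bookkeeping function or equality displayed; NOT proved;
nothing instantiated on Bałaban's densities. [folklore] -/
theorem dressedStability_of_canonicalSliceWinSchedules
    -- the H2 dictionary the canonical data are built from
    (hQ : ∀ (a : P) (K : ℕ), ∀ b k, (fun U z => (𝒬 a K) b k U z - (q a K) b k U) =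
      fun U z => (c a K) b k * ∑ x ∈ (Sg a K) k b, ((Fn a K) x.1 x.2 k (U + z) - (Fn a K) x.1 x.2 k (U + (z₁ a K) b k)))
    (hSg : ∀ (a : P) (K : ℕ), ∀ k b, ∀ x ∈ (Sg a K) k b, x.1 ∈ (S a K) k b ∧ (𝒯.B a K).birthScale x.1 ≤ x.2 ∧ x.2 ≤ k)
    -- the two binders PARTICULAR to the assembled slice-window face (cutoff-free source tie, per-step slice guard)
    (hcm : ∀ (a : P) (K : ℕ), ∀ b k, ‖(c a K) b k‖ ≤ m)
    (hδfwk : ∀ (a : P) (K : ℕ), ∀ b k, ∀ x ∈ (Sg a K) k b, (δf a K) b k x ≤ (W a K).wc k)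
    (hvN₀ : (v : ℝ) * mB ≤ N₀) (hA : 0 ≤ A)
    (hfan : fanout A N₀ ρ' < 1) (hamp : absorbAmplitude β₀ A N₀ ρ' ≤ A₀) :
    DressedStability 𝒯 :=
  ⟨_, _, _, dressedStabilityWith_of_canonicalSliceWinSchedules 𝒯 W hκ Anch hratio hL hcbar hN₀ hA₀ hm hloc hρ'1 hsmall hr hcδ
    hsl hFn h𝒢 hB hE hδf hDμ hz₁ hpairx hinv hmeas hdefwk hrate hne hsup hc0 hcb hreg hs₀ hLb hmult hscale hhoused hvol holder
    hsub habs hβ hQ hSg hcm hδfwk hvN₀ hA hfan hamp⟩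

/-- **THE CANONICAL TERMINAL FACE ⟹ ROOT-B `DressedBudget 𝒯 wt`** [bookkeeping]: with nonnegative cube weights bounded by `w̄` and the
SAME anchoring read as the bookings' positional count (`1 ≤ v`), S3k's `dressedBudget_of_suppliedSliceWinSchedules` BY NAME at the
canonical data. [folklore] -/
theorem dressedBudget_of_canonicalSliceWinSchedules
    -- the H2 dictionary the canonical data are built from
    (hQ : ∀ (a : P) (K : ℕ), ∀ b k, (fun U z => (𝒬 a K) b k U z - (q a K) b k U) =
      fun U z => (c a K) b k * ∑ x ∈ (Sg a K) k b, ((Fn a K) x.1 x.2 k (U + z) - (Fn a K) x.1 x.2 k (U + (z₁ a K) b k)))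
    (hSg : ∀ (a : P) (K : ℕ), ∀ k b, ∀ x ∈ (Sg a K) k b, x.1 ∈ (S a K) k b ∧ (𝒯.B a K).birthScale x.1 ≤ x.2 ∧ x.2 ≤ k)
    -- the two binders PARTICULAR to the assembled slice-window face (cutoff-free source tie, per-step slice guard)
    (hcm : ∀ (a : P) (K : ℕ), ∀ b k, ‖(c a K) b k‖ ≤ m)
    (hδfwk : ∀ (a : P) (K : ℕ), ∀ b k, ∀ x ∈ (Sg a K) k b, (δf a K) b k x ≤ (W a K).wc k)
    (hvN₀ : (v : ℝ) * mB ≤ N₀) (hA : 0 ≤ A)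
    (hfan : fanout A N₀ ρ' < 1) (hamp : absorbAmplitude β₀ A N₀ ρ' ≤ A₀)
    {wt : P → ℕ → ℕ → ℝ} {wbar : ℝ} (hwbar : 0 ≤ wbar)
    (hw0 : ∀ a K, ∀ j ≤ K, 0 ≤ wt a K j) (hwb : ∀ a K, ∀ j ≤ K, wt a K j ≤ wbar) (hv : 1 ≤ v) :
    DressedBudget 𝒯 wt :=
  dressedBudget_of_suppliedSliceWinSchedules 𝒯 W hκ
    (s1 := fun a K => s1Mod (𝒯.T a K).gen r (fun _ : ℕ => alphaCell κ) (c a K) (Sg a K) (δf a K))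
    (Asz := fun a K =>
      aszRec (𝒯.T a K).gen (s a K) (s1Mod (𝒯.T a K).gen r (fun _ : ℕ => alphaCell κ) (c a K) (Sg a K) (δf a K)))
    Anch hratio hL hcbar hN₀ hA₀ hm hloc hρ'1 hsmall hr hcδ hsl hFn h𝒢 hB hE hQ hSg
    (fun a K b k => s1Mod_eq (𝒯.T a K).gen r (fun _ : ℕ => alphaCell κ) (c a K) (Sg a K) (δf a K) b k)
    (fun a K f k'' =>
      aszRec_birth (𝒯.T a K).gen (s a K) (s1Mod (𝒯.T a K).gen r (fun _ : ℕ => alphaCell κ) (c a K) (Sg a K) (δf a K)) f k'')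
    (fun a K f _ _ _ hk =>
      aszRec_succ (𝒯.T a K).gen (s a K) (s1Mod (𝒯.T a K).gen r (fun _ : ℕ => alphaCell κ) (c a K) (Sg a K) (δf a K)) f hk)
    hδf hDμ hz₁ hpairx hinv hmeas hdefwk hrate hne hsup hc0 hcb hreg hs₀ hLb hmult hscale hhoused hvol holder hsub habs hβ hcm
    hδfwk hvN₀ hA hfan hamp hwbar hw0 hwb hv

end EndAll

end Summit.QuantumFields.BalabanUV.T4Continuum.NE1p.DressedStabilityOfCanonicalSliceWinSchedules

end
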